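import Mathlib.RingTheory.MvPolynomial.Ideal
import Mathlib.RingTheory.MvPolynomial.Basic
import Mathlib.Algebra.Algebra.Operations
import Mathlib.Data.Fin.VecNotation
import HarnessLib

/-!
# [OURS · L1 W3.6 · kill test K3.6] Power structure of the ideal of THREE CONCURRENT LINES (specimen (B) of the «ORD-POW CUT» slot):
# ordinary ≠ order-defined powers (witness `x₀x₁x₂`), yet `D_{2k} = (D_2)^k` — the even order-defined powers are powers of the second one

Cell `res-hironaka`, rung L (rescue) of LADDER-RESOLUTION, row L-G3 (datum `Ě`), slot W3.6 «ORD-POW CUT» (director-resolution g3 RULING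
2026-08-27T00:42:40Z, kill-test-only slot), kill test K3.6 (res-plan-2 PAYLOAD-READY 00:55:38Z + AMENDMENT 1 01:06:33Z), seat res-L1-k36;
pre-registration `L/res-L1-k36/PREREG-K3.6.md` (sha16 4a24d745aca0e021, STATUS «KILL-TEST K3.6 REGISTERED»). HOST (custody, no new route):
the EXISTING crux `Theses.MarkedTransfer.HypersurfaceOrderReduction` (stmt-ResolutionOfSingularities-16155), `--supports … --as helper`.

WHAT THIS FILE IS. Polynomial-level commutative algebra over any commutative ring `K` (nontrivial where a non-membership is claimed) about
the configuration `C ⊂ 𝔸⁴ = Spec K[x₀,x₁,x₂,x₃]` of the THREE COORDINATE AXES of `{x₃ = 0}` — `Sing(E_B)` of res-L1-type-o4's specimen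
`E_B = ((x₃²) + (x₀x₁, x₁x₂, x₀x₂)^M·𝒪, 2)` (NOTE 2026-08-26T23:59:42Z). `threeLinesExps b` = exponent vectors `v` with `b ≤ v₁+v₂+v₃`,
`b ≤ v₀+v₂+v₃`, `b ≤ v₀+v₁+v₃` («order `≥ b` at the generic point of each axis»); `threeLinesDiffPow K b` = `D_b`, the ideal of polynomials
supported on it (Mathlib `MvPolynomial.restrictSupportIdeal`) — the `b`-th ORDER-DEFINED power of `D_1 = (x₃, x₀x₁, x₁x₂, x₀x₂)`
(`threeLinesDiffPow_one_eq_span`). Proved: `threeLinesDiffPow_mul_le` (`D_a·D_b ≤ D_{a+b}`); `X012_mem_threeLinesDiffPow_two`,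
`X012_not_mem_threeLinesDiffPow_one_sq`, `not_forall_threeLinesDiffPow_eq_pow` (`x₀x₁x₂ ∈ D_2 ∖ D_1²`: the registered witness that column
C3 «OrdPowAlong C» FAILS for (B)); **`threeLinesDiffPow_two_mul`: `D_{2k} = (D_2)^k` for every `k`** and `threeLinesDiffPow_two_mul_add_one`:
`D_{2k+1} = D_1·(D_2)^k` — res-type-010's informal computation (STATUS 2026-08-27T01:04:14Z «𝔭^((m)) = 𝔭^m + xyz·𝔭^((m−2)), R_s(𝔭) =
R[𝔭t, xyz t²], diffPower C (2k) = (diffPower C 2)^k») CERTIFIED at the polynomial level; hence `threeLinesDiffPow_sq_le_two_pow`: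
`(D_b)² ≤ (D_2)^b`, the inequality the level-2 stability argument consumes (prereg column C4 at `b₀ = 2`).

HOW IT IS USED (hand glue G2 of the prereg, NOT kernel-checked here): on `𝔸⁴` the tree's `S06BaseHike.diffPower C b` (largest ideal sheaf
of order `≥ b` at every point of `C`, `Lib/CoreFocusCandidates.lean`) is the sheaf of `D_b`; with `(D_b)² ≤ D_{2b} = (D_2)^b` the tree's
`sIncl_of_le` / `sEq_pow_mul` / `stableAt_of_forall_sIncl_symbExp` give `StableAt E_B C 2`, hence the core focusing `focusAt E_B C 2`
(`Lib/CoreFocusTower.isCoreFocus_focusAt_of_stableAt`, p480139) although `CampaignW31.OrdPowAlong C` (p476257/p480089) fails. The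
scheme-level sentences are res-type-010's offered follow-up («diffPower of monomial configurations»), not claimed here.

HONEST FRAMING. Everything here is OURS (elementary algebra about OUR specimen); NOTHING in this file is a statement of H. Hironaka's
manuscript (2017-03-23, [Hironaka2017], lit key `paper:url-3343fd9e678b`) and nothing of it is asserted; the manuscript stays «under
review». AI bookkeeping, weaker than expert review. Classical context (not a premise): for `I = (xy, xz, yz) ⊂ K[x,y,z]`,
`I^{(2)} = (xyz, x²y², x²z², y²z²) ≠ I²` [Carlini–Hà–Harbourne–Van Tuyl 2020, Example 11.2 p.135].
-/

noncomputable section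

set_option linter.dupNamespace false -- mandated namespace of this single-conjunct summit

open MvPolynomial
open scoped Pointwise

namespace Summit.ResolutionOfSingularities.ResolutionOfSingularities.Theorems

namespace CampaignW36

/-- [OURS · L1 W3.6] plumbing (REAL definition): the exponent vector `(a, b, c, e)` of `x₀^a x₁^b x₂^c x₃^e` (`x₀,x₁,x₂,x₃` = `x,y,z,w`
of specimen (B)). NOT a statement of the manuscript. [folklore] -/
def mk4 (a b c e : ℕ) : Fin 4 →₀ ℕ :=
  Finsupp.equivFunOnFinite.symm ![a, b, c, e]

/-- Coordinate `0` of `mk4`. [folklore] -/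
@[simp] theorem mk4_apply_zero (a b c e : ℕ) : mk4 a b c e 0 = a := rfl
/-- Coordinate `1` of `mk4`. [folklore] -/
@[simp] theorem mk4_apply_one (a b c e : ℕ) : mk4 a b c e 1 = b := rfl
/-- Coordinate `2` of `mk4`. [folklore] -/
@[simp] theorem mk4_apply_two (a b c e : ℕ) : mk4 a b c e 2 = c := rfl
/-- Coordinate `3` of `mk4`. [folklore] -/
@[simp] theorem mk4_apply_three (a b c e : ℕ) : mk4 a b c e 3 = e := rfl

/-- Every exponent vector in four variables is an `mk4`. [folklore] -/
theorem eq_mk4 (v : Fin 4 →₀ ℕ) : v = mk4 (v 0) (v 1) (v 2) (v 3) := by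
  ext i; fin_cases i <;> rfl

/-- Coordinatewise order on `mk4`. [folklore] -/
theorem mk4_le_mk4_iff (a b c e a' b' c' e' : ℕ) :
    mk4 a b c e ≤ mk4 a' b' c' e' ↔ a ≤ a' ∧ b ≤ b' ∧ c ≤ c' ∧ e ≤ e' := by
  refine ⟨fun h => ⟨h 0, h 1, h 2, h 3⟩, fun ⟨h0, h1, h2, h3⟩ i => ?_⟩
  fin_cases i <;> assumption

/-- Coordinatewise sum on `mk4`. [folklore] -/
@[simp] theorem mk4_add_mk4 (a b c e a' b' c' e' : ℕ) :
    mk4 a b c e + mk4 a' b' c' e' = mk4 (a + a') (b + b') (c + c') (e + e') := by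
  ext i; fin_cases i <;> rfl

/-- Coordinatewise truncated difference on `mk4`. [folklore] -/
@[simp] theorem mk4_tsub_mk4 (a b c e a' b' c' e' : ℕ) :
    mk4 a b c e - mk4 a' b' c' e' = mk4 (a - a') (b - b') (c - c') (e - e') := by
  ext i; fin_cases i <;> rfl

/-- [OURS · L1 W3.6] (REAL definition) the exponent vectors `v` of monomials whose order at the generic point of EACH of the three
coordinate axes of `{x₃ = 0} ⊂ 𝔸⁴` is `≥ b`: `b ≤ v₁+v₂+v₃` (the `x₀`-axis), `b ≤ v₀+v₂+v₃` (the `x₁`-axis), `b ≤ v₀+v₁+v₃` (the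
`x₂`-axis). NOT a statement of the manuscript. [folklore] -/
def threeLinesExps (b : ℕ) : Set (Fin 4 →₀ ℕ) :=
  {v | b ≤ v 1 + v 2 + v 3 ∧ b ≤ v 0 + v 2 + v 3 ∧ b ≤ v 0 + v 1 + v 3}

/-- Membership of an `mk4` in `threeLinesExps n`, as three linear inequalities. [folklore] -/
@[simp] theorem mk4_mem_threeLinesExps_iff (n a b c e : ℕ) :
    mk4 a b c e ∈ threeLinesExps n ↔ n ≤ b + c + e ∧ n ≤ a + c + e ∧ n ≤ a + b + e := Iff.rfl

/-- `threeLinesExps b` is an upper set (divisibility-closed upwards). [folklore] -/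
theorem isUpperSet_threeLinesExps (b : ℕ) : IsUpperSet (threeLinesExps b) := by
  intro v w hvw hv
  rw [eq_mk4 v] at hv hvw
  rw [eq_mk4 w, mk4_le_mk4_iff] at hvw
  rw [eq_mk4 w, mk4_mem_threeLinesExps_iff]
  rw [mk4_mem_threeLinesExps_iff] at hv
  omega

/-- `threeLinesExps 0` is everything. [folklore] -/
theorem threeLinesExps_zero : threeLinesExps 0 = Set.univ :=
  Set.eq_univ_of_forall fun _ => ⟨Nat.zero_le _, Nat.zero_le _, Nat.zero_le _⟩

/-- Additivity: `threeLinesExps a + threeLinesExps b ⊆ threeLinesExps (a + b)`. [folklore] -/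
theorem threeLinesExps_add_subset (a b : ℕ) : threeLinesExps a + threeLinesExps b ⊆ threeLinesExps (a + b) := by
  intro v hv
  obtain ⟨s, hs, t, ht, rfl⟩ := Set.mem_add.mp hv
  rw [eq_mk4 s, mk4_mem_threeLinesExps_iff] at hs
  rw [eq_mk4 t, mk4_mem_threeLinesExps_iff] at ht
  rw [eq_mk4 s, eq_mk4 t, mk4_add_mk4, mk4_mem_threeLinesExps_iff]
  omega

/-- Bookkeeping for the peeling lemmas: an explicit `g = mk4 a' b' c' e'` with the three checks. [folklore] -/
theorem peel_aux {m n a b c e : ℕ} (a' b' c' e' : ℕ) (hg : mk4 a' b' c' e' ∈ threeLinesExps m)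
    (hle : a' ≤ a ∧ b' ≤ b ∧ c' ≤ c ∧ e' ≤ e) (hrest : mk4 (a - a') (b - b') (c - c') (e - e') ∈ threeLinesExps n) :
    ∃ g ∈ threeLinesExps m, g ≤ mk4 a b c e ∧ mk4 a b c e - g ∈ threeLinesExps n :=
  ⟨mk4 a' b' c' e', hg, (mk4_le_mk4_iff _ _ _ _ _ _ _ _).mpr hle, by rwa [mk4_tsub_mk4]⟩

/-- **Peeling, even case**: order `≥ 2k+2` along the three axes is `g + v'` with `g` of order `≥ 2`, `v'` of order `≥ 2k` — peel `x₃²`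
if `e ≥ 2`; if `e = 1`, `x₃` times the pair of `x`-variables with exponent sum `≥ 2k+2` (parity); if `e = 0`, `x₀x₁x₂` or the square of a
pair (res-type-010's induction «on the minimal exponent», STATUS 2026-08-27T01:04:14Z, made explicit). [folklore] -/
theorem exists_peel_two (k : ℕ) {v : Fin 4 →₀ ℕ} (hv : v ∈ threeLinesExps (2 * k + 2)) :
    ∃ g ∈ threeLinesExps 2, g ≤ v ∧ v - g ∈ threeLinesExps (2 * k) := by
  rw [eq_mk4 v] at hv ⊢
  generalize v 0 = a at hv ⊢; generalize v 1 = b at hv ⊢; generalize v 2 = c at hv ⊢; generalize v 3 = e at hv ⊢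
  obtain ⟨h1, h2, h3⟩ := (mk4_mem_threeLinesExps_iff _ _ _ _ _).mp hv
  by_cases he2 : 2 ≤ e
  · exact peel_aux 0 0 0 2 (by simp) (by omega) (by rw [mk4_mem_threeLinesExps_iff]; omega)
  by_cases he1 : e = 1
  · subst he1
    by_cases hab : 2 * k + 2 ≤ a + b ∧ 1 ≤ a ∧ 1 ≤ b
    · exact peel_aux 1 1 0 1 (by simp) (by omega) (by rw [mk4_mem_threeLinesExps_iff]; omega)
    by_cases hbc : 2 * k + 2 ≤ b + c ∧ 1 ≤ b ∧ 1 ≤ c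
    · exact peel_aux 0 1 1 1 (by simp) (by omega) (by rw [mk4_mem_threeLinesExps_iff]; omega)
    have hac : 2 * k + 2 ≤ a + c ∧ 1 ≤ a ∧ 1 ≤ c := by omega
    exact peel_aux 1 0 1 1 (by simp) (by omega) (by rw [mk4_mem_threeLinesExps_iff]; omega)
  have he0 : e = 0 := by omega
  subst he0
  by_cases ha : a = 0
  · exact peel_aux 0 2 2 0 (by simp) (by omega) (by rw [mk4_mem_threeLinesExps_iff]; omega)
  by_cases hb : b = 0
  · exact peel_aux 2 0 2 0 (by simp) (by omega) (by rw [mk4_mem_threeLinesExps_iff]; omega)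
  by_cases hc : c = 0
  · exact peel_aux 2 2 0 0 (by simp) (by omega) (by rw [mk4_mem_threeLinesExps_iff]; omega)
  exact peel_aux 1 1 1 0 (by simp) (by omega) (by rw [mk4_mem_threeLinesExps_iff]; omega)

/-- **Peeling, odd case**: order `≥ 2k+1` is `g + v'` with `g` of order `≥ 1` and `v'` of order `≥ 2k` (peel `x₃` if `e ≥ 1`, else
the pair of `x`-variables whose exponent sum is `≥ 2k+2`). [folklore] -/
theorem exists_peel_one (k : ℕ) {v : Fin 4 →₀ ℕ} (hv : v ∈ threeLinesExps (2 * k + 1)) :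
    ∃ g ∈ threeLinesExps 1, g ≤ v ∧ v - g ∈ threeLinesExps (2 * k) := by
  rw [eq_mk4 v] at hv ⊢
  generalize v 0 = a at hv ⊢; generalize v 1 = b at hv ⊢; generalize v 2 = c at hv ⊢; generalize v 3 = e at hv ⊢
  obtain ⟨h1, h2, h3⟩ := (mk4_mem_threeLinesExps_iff _ _ _ _ _).mp hv
  by_cases he1 : 1 ≤ e
  · exact peel_aux 0 0 0 1 (by simp) (by omega) (by rw [mk4_mem_threeLinesExps_iff]; omega)
  have he0 : e = 0 := by omega
  subst he0
  by_cases hab : 2 * k + 2 ≤ a + b ∧ 1 ≤ a ∧ 1 ≤ b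
  · exact peel_aux 1 1 0 0 (by simp) (by omega) (by rw [mk4_mem_threeLinesExps_iff]; omega)
  by_cases hbc : 2 * k + 2 ≤ b + c ∧ 1 ≤ b ∧ 1 ≤ c
  · exact peel_aux 0 1 1 0 (by simp) (by omega) (by rw [mk4_mem_threeLinesExps_iff]; omega)
  have hac : 2 * k + 2 ≤ a + c ∧ 1 ≤ a ∧ 1 ≤ c := by omega
  exact peel_aux 1 0 1 0 (by simp) (by omega) (by rw [mk4_mem_threeLinesExps_iff]; omega)

/-- `k • threeLinesExps 2 ⊆ threeLinesExps (2k)` (iterated additivity). [folklore] -/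
theorem nsmul_threeLinesExps_two_subset (k : ℕ) (hk : 0 < k) : k • threeLinesExps 2 ⊆ threeLinesExps (2 * k) := by
  induction k with
  | zero => exact absurd hk (lt_irrefl 0)
  | succ k ih =>
    rcases Nat.eq_zero_or_pos k with rfl | hk'
    · rw [one_nsmul]
    · rw [succ_nsmul]
      intro v hv
      obtain ⟨s, hs, t, ht, rfl⟩ := Set.mem_add.mp hv
      have h := threeLinesExps_add_subset (2 * k) 2 (Set.add_mem_add (ih hk' hs) ht)
      rwa [show 2 * k + 2 = 2 * (k + 1) by ring] at h

/-- **`threeLinesExps (2k) = k • threeLinesExps 2`** for `k ≥ 1`: the even order-defined exponent sets are the `k`-fold sums of the second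
one (the semigroup form of `D_{2k} = D_2^k`). [folklore] -/
theorem threeLinesExps_two_mul (k : ℕ) (hk : 0 < k) : threeLinesExps (2 * k) = k • threeLinesExps 2 := by
  refine Set.Subset.antisymm ?_ (nsmul_threeLinesExps_two_subset k hk)
  induction k with
  | zero => exact absurd hk (lt_irrefl 0)
  | succ k ih =>
    intro v hv
    rcases Nat.eq_zero_or_pos k with rfl | hk'
    · rwa [one_nsmul]
    · rw [show 2 * (k + 1) = 2 * k + 2 by ring] at hv
      obtain ⟨g, hg, hgv, hv'⟩ := exists_peel_two k hv
      rw [succ_nsmul, ← tsub_add_cancel_of_le hgv]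
      exact Set.add_mem_add (ih hk' hv') hg

/-- **`threeLinesExps (2k+1) = threeLinesExps 1 + k • threeLinesExps 2`** for `k ≥ 1` (odd order-defined exponent sets). [folklore] -/
theorem threeLinesExps_two_mul_add_one (k : ℕ) (hk : 0 < k) :
    threeLinesExps (2 * k + 1) = threeLinesExps 1 + k • threeLinesExps 2 := by
  refine Set.Subset.antisymm ?_ ?_
  · intro v hv
    obtain ⟨g, hg, hgv, hv'⟩ := exists_peel_one k hv
    have hv'' : v - g ∈ k • threeLinesExps 2 := by rwa [← threeLinesExps_two_mul k hk]
    rw [← tsub_add_cancel_of_le hgv, add_comm (v - g) g]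
    exact Set.add_mem_add hg hv''
  · rw [← threeLinesExps_two_mul k hk]
    intro v hv
    have h := threeLinesExps_add_subset 1 (2 * k) hv
    rwa [add_comm 1] at h

/-! ## The order-defined powers `D_b = threeLinesDiffPow K b` as ideals of `K[x₀,x₁,x₂,x₃]` -/

variable (K : Type*) [CommRing K]

/-- [OURS · L1 W3.6] (REAL definition) `D_b`: the ideal of polynomials in `K[x₀,x₁,x₂,x₃]` all of whose monomials have order `≥ b` at
the generic point of each coordinate axis of `{x₃ = 0}` — the `b`-th ORDER-DEFINED power of the ideal of the three concurrent lines of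
specimen (B) (Mathlib `MvPolynomial.restrictSupportIdeal` of `threeLinesExps b`). NOT a statement of the manuscript. [folklore] -/
def threeLinesDiffPow (b : ℕ) : Ideal (MvPolynomial (Fin 4) K) :=
  restrictSupportIdeal K (threeLinesExps b) (isUpperSet_threeLinesExps b)

/-- Unfolding to Mathlib's support submodule. [folklore] -/
theorem restrictScalars_threeLinesDiffPow (b : ℕ) :
    (threeLinesDiffPow K b).restrictScalars K = restrictSupport K (threeLinesExps b) :=
  rfl

/-- Membership: `f ∈ D_b` iff every exponent vector in the support of `f` lies in `threeLinesExps b`. [folklore] -/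
theorem mem_threeLinesDiffPow_iff {b : ℕ} {f : MvPolynomial (Fin 4) K} :
    f ∈ threeLinesDiffPow K b ↔ ∀ v ∈ f.support, v ∈ threeLinesExps b := by
  change f ∈ (threeLinesDiffPow K b).restrictScalars K ↔ _
  rw [restrictScalars_threeLinesDiffPow, mem_restrictSupport_iff]
  exact ⟨fun h v hv => h hv, fun h v hv => h v hv⟩

/-- `D_0` is the unit ideal. [folklore] -/
theorem threeLinesDiffPow_zero : threeLinesDiffPow K 0 = ⊤ := by
  apply Submodule.restrictScalars_injective K
  rw [restrictScalars_threeLinesDiffPow, threeLinesExps_zero, restrictSupport_univ]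
  rfl

/-- `D_b` is the monomial ideal spanned by the monomials of `threeLinesExps b`. [folklore] -/
theorem threeLinesDiffPow_eq_span (b : ℕ) :
    threeLinesDiffPow K b = Ideal.span ((fun v => monomial v (1 : K)) '' threeLinesExps b) := by
  refine le_antisymm ?_ (Ideal.span_le.mpr ?_)
  · intro f hf
    have hf' : f ∈ restrictSupport K (threeLinesExps b) := hf
    rw [restrictSupport_eq_span] at hf'
    exact (Submodule.span_le.mpr fun x hx => Ideal.subset_span hx : Submodule.span K _ ≤
      (Ideal.span ((fun v => monomial v (1 : K)) '' threeLinesExps b)).restrictScalars K) hf'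
  · rintro _ ⟨v, hv, rfl⟩
    change monomial v (1 : K) ∈ (threeLinesDiffPow K b).restrictScalars K
    rw [restrictScalars_threeLinesDiffPow, monomial_mem_restrictSupport]
    exact Or.inl hv

/-- **`D_a · D_b ≤ D_{a+b}`** (orders add under multiplication). [folklore] -/
theorem threeLinesDiffPow_mul_le (a b : ℕ) :
    threeLinesDiffPow K a * threeLinesDiffPow K b ≤ threeLinesDiffPow K (a + b) := by
  intro f hf
  have hf' : f ∈ ((threeLinesDiffPow K a * threeLinesDiffPow K b).restrictScalars K) := hf
  rw [Submodule.restrictScalars_mul, restrictScalars_threeLinesDiffPow, restrictScalars_threeLinesDiffPow,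
    ← restrictSupport_add] at hf'
  exact (restrictSupport_mono K (threeLinesExps_add_subset a b)) hf'

/-- **`D_{2k} = (D_2)^k`** for every `k` — res-type-010's identity «diffPower C (2k) = (diffPower C 2)^k» (STATUS 2026-08-27T01:04:14Z) at
the polynomial level: the even order-defined powers are the ORDINARY powers of the second one («`StableAt E_B C 2`», column C4). [folklore] -/
theorem threeLinesDiffPow_two_mul (k : ℕ) : threeLinesDiffPow K (2 * k) = threeLinesDiffPow K 2 ^ k := by
  rcases Nat.eq_zero_or_pos k with rfl | hk
  · rw [Nat.mul_zero, pow_zero, threeLinesDiffPow_zero, Ideal.one_eq_top]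
  · apply Submodule.restrictScalars_injective K
    rw [Submodule.restrictScalars_pow hk.ne', restrictScalars_threeLinesDiffPow, restrictScalars_threeLinesDiffPow,
      ← restrictSupport_nsmul, threeLinesExps_two_mul k hk]

/-- **`D_{2k+1} = D_1 · (D_2)^k`** for every `k` (the odd order-defined powers; with `threeLinesDiffPow_two_mul`: the order-defined
power algebra `⊕_b D_b` is generated by `D_1` in degree 1 and `D_2` in degree 2 — «`R_s(𝔭) = R[𝔭t, xyz t²]`»). [folklore] -/
theorem threeLinesDiffPow_two_mul_add_one (k : ℕ) :
    threeLinesDiffPow K (2 * k + 1) = threeLinesDiffPow K 1 * threeLinesDiffPow K 2 ^ k := by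
  rcases Nat.eq_zero_or_pos k with rfl | hk
  · rw [Nat.mul_zero, pow_zero, mul_one]
  · apply Submodule.restrictScalars_injective K
    rw [Submodule.restrictScalars_mul, Submodule.restrictScalars_pow hk.ne', restrictScalars_threeLinesDiffPow,
      restrictScalars_threeLinesDiffPow, restrictScalars_threeLinesDiffPow, ← restrictSupport_nsmul, ← restrictSupport_add,
      threeLinesExps_two_mul_add_one k hk]

/-- **`(D_b)² ≤ (D_2)^b`** for every `b` — the inequality consumed by the level-2 stability argument: `(𝓘_C^⟨b⟩)² ≤ 𝓘_C^⟨2b⟩ = (𝓘_C^⟨2⟩)^b`,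
whence `𝔖((𝓘_C^⟨2⟩, 2)) ⊆ 𝔖((𝓘_C^⟨b⟩, b))` by the tree's [F1] power law. [folklore] -/
theorem threeLinesDiffPow_sq_le_two_pow (b : ℕ) : threeLinesDiffPow K b ^ 2 ≤ threeLinesDiffPow K 2 ^ b := by
  rw [pow_two, ← threeLinesDiffPow_two_mul, two_mul]
  exact threeLinesDiffPow_mul_le K b b

/-! ## The radical ideal `D_1 = (x₃, x₀x₁, x₁x₂, x₀x₂)` and the witness `x₀x₁x₂ ∈ D_2 ∖ D_1²` -/

/-- `x₃ = x^{(0,0,0,1)}`. [folklore] -/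
theorem X3_eq : (X 3 : MvPolynomial (Fin 4) K) = monomial (mk4 0 0 0 1) 1 := by
  rw [X]; exact congrArg (monomial · (1 : K)) (by ext i; fin_cases i <;> simp [mk4, Fin.ext_iff])

/-- `x₀x₁ = x^{(1,1,0,0)}`. [folklore] -/
theorem X01_eq : (X 0 * X 1 : MvPolynomial (Fin 4) K) = monomial (mk4 1 1 0 0) 1 := by
  rw [X, X, monomial_mul, one_mul]
  exact congrArg (monomial · (1 : K)) (by ext i; fin_cases i <;> simp [mk4, Fin.ext_iff])

/-- `x₁x₂ = x^{(0,1,1,0)}`. [folklore] -/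
theorem X12_eq : (X 1 * X 2 : MvPolynomial (Fin 4) K) = monomial (mk4 0 1 1 0) 1 := by
  rw [X, X, monomial_mul, one_mul]
  exact congrArg (monomial · (1 : K)) (by ext i; fin_cases i <;> simp [mk4, Fin.ext_iff])

/-- `x₀x₂ = x^{(1,0,1,0)}`. [folklore] -/
theorem X02_eq : (X 0 * X 2 : MvPolynomial (Fin 4) K) = monomial (mk4 1 0 1 0) 1 := by
  rw [X, X, monomial_mul, one_mul]
  exact congrArg (monomial · (1 : K)) (by ext i; fin_cases i <;> simp [mk4, Fin.ext_iff])

/-- `x₀x₁x₂ = x^{(1,1,1,0)}`. [folklore] -/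
theorem X012_eq : (X 0 * X 1 * X 2 : MvPolynomial (Fin 4) K) = monomial (mk4 1 1 1 0) 1 := by
  rw [X, X, X, monomial_mul, monomial_mul, one_mul, one_mul]
  exact congrArg (monomial · (1 : K)) (by ext i; fin_cases i <;> simp [mk4, Fin.ext_iff])

/-- A monomial divisible by a member of an ideal's generating set lies in the ideal. [folklore] -/
theorem monomial_mem_span_of_le {S : Set (MvPolynomial (Fin 4) K)} {u v : Fin 4 →₀ ℕ}
    (hu : monomial u (1 : K) ∈ S) (huv : u ≤ v) : monomial v (1 : K) ∈ Ideal.span S := by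
  have hsplit : monomial v (1 : K) = monomial (v - u) 1 * monomial u 1 := by
    rw [monomial_mul, one_mul, tsub_add_cancel_of_le huv]
  rw [hsplit]
  exact Ideal.mul_mem_left _ _ (Ideal.subset_span hu)

/-- `D_1` is the ideal `(x₃, x₀x₁, x₁x₂, x₀x₂)` of the three coordinate axes of `{x₃ = 0}` (reduced structure). [folklore] -/
theorem threeLinesDiffPow_one_eq_span :
    threeLinesDiffPow K 1 = Ideal.span {(X 3 : MvPolynomial (Fin 4) K), X 0 * X 1, X 1 * X 2, X 0 * X 2} := by
  rw [X3_eq, X01_eq, X12_eq, X02_eq]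
  refine le_antisymm ?_ (Ideal.span_le.mpr ?_)
  · rw [threeLinesDiffPow_eq_span]
    refine Ideal.span_le.mpr ?_
    rintro _ ⟨v, hv, rfl⟩
    rw [eq_mk4 v, mk4_mem_threeLinesExps_iff] at hv; rw [eq_mk4 v]
    by_cases h3 : 1 ≤ v 3
    · exact monomial_mem_span_of_le K (u := mk4 0 0 0 1) (by simp) (by rw [mk4_le_mk4_iff]; omega)
    by_cases h01 : 1 ≤ v 0 ∧ 1 ≤ v 1
    · exact monomial_mem_span_of_le K (u := mk4 1 1 0 0) (by simp) (by rw [mk4_le_mk4_iff]; omega)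
    by_cases h12 : 1 ≤ v 1 ∧ 1 ≤ v 2
    · exact monomial_mem_span_of_le K (u := mk4 0 1 1 0) (by simp) (by rw [mk4_le_mk4_iff]; omega)
    have h02 : 1 ≤ v 0 ∧ 1 ≤ v 2 := by omega
    exact monomial_mem_span_of_le K (u := mk4 1 0 1 0) (by simp) (by rw [mk4_le_mk4_iff]; omega)
  · intro g hg
    simp only [Set.mem_insert_iff, Set.mem_singleton_iff] at hg
    rcases hg with rfl | rfl | rfl | rfl <;>
      · change monomial _ (1 : K) ∈ (threeLinesDiffPow K 1).restrictScalars K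
        rw [restrictScalars_threeLinesDiffPow, monomial_mem_restrictSupport, mk4_mem_threeLinesExps_iff]
        left; omega

/-- **`x₀x₁x₂ ∈ D_2`**: the product of the three `x`-variables has order `≥ 2` at the generic point of each axis. [folklore] -/
theorem X012_mem_threeLinesDiffPow_two :
    (X 0 * X 1 * X 2 : MvPolynomial (Fin 4) K) ∈ threeLinesDiffPow K 2 := by
  rw [X012_eq]
  change monomial _ (1 : K) ∈ (threeLinesDiffPow K 2).restrictScalars K
  rw [restrictScalars_threeLinesDiffPow, monomial_mem_restrictSupport, mk4_mem_threeLinesExps_iff]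
  left; omega

/-- The exponent `(1,1,1,0)` of `x₀x₁x₂` is NOT a sum of two exponents of order `≥ 1` along the three axes. [folklore] -/
theorem mk4_one_one_one_zero_not_mem_add : mk4 1 1 1 0 ∉ threeLinesExps 1 + threeLinesExps 1 := by
  intro h
  obtain ⟨s, hs, t, ht, hst⟩ := Set.mem_add.mp h
  rw [eq_mk4 s, mk4_mem_threeLinesExps_iff] at hs
  rw [eq_mk4 t, mk4_mem_threeLinesExps_iff] at ht
  rw [eq_mk4 s, eq_mk4 t, mk4_add_mk4] at hst
  have e0 := congrArg (fun u : Fin 4 →₀ ℕ => u 0) hst; have e1 := congrArg (fun u : Fin 4 →₀ ℕ => u 1) hst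
  have e2 := congrArg (fun u : Fin 4 →₀ ℕ => u 2) hst; have e3 := congrArg (fun u : Fin 4 →₀ ℕ => u 3) hst
  simp only [mk4_apply_zero, mk4_apply_one, mk4_apply_two, mk4_apply_three] at e0 e1 e2 e3
  omega

/-- **`x₀x₁x₂ ∉ D_1²`** (nontrivial `K`): the registered witness that the ORDINARY square of the ideal of the three concurrent lines is
strictly smaller than the order-defined one — «`OrdPowAlong C`» FAILS for specimen (B) at the polynomial level (column C3). [folklore] -/
theorem X012_not_mem_threeLinesDiffPow_one_sq [Nontrivial K] :
    (X 0 * X 1 * X 2 : MvPolynomial (Fin 4) K) ∉ threeLinesDiffPow K 1 ^ 2 := by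
  intro h
  have h' : (X 0 * X 1 * X 2 : MvPolynomial (Fin 4) K) ∈ (threeLinesDiffPow K 1 ^ 2).restrictScalars K := h
  rw [Submodule.restrictScalars_pow two_ne_zero, restrictScalars_threeLinesDiffPow, ← restrictSupport_nsmul, two_nsmul,
    X012_eq, monomial_mem_restrictSupport] at h'
  rcases h' with h' | h'
  · exact mk4_one_one_one_zero_not_mem_add h'
  · exact one_ne_zero h'

/-- **`D_2 ≠ D_1²`** (nontrivial `K`): ordinary ≠ order-defined already at the second power. [folklore] -/
theorem threeLinesDiffPow_two_ne_sq [Nontrivial K] : threeLinesDiffPow K 2 ≠ threeLinesDiffPow K 1 ^ 2 := fun h =>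
  X012_not_mem_threeLinesDiffPow_one_sq K (h ▸ X012_mem_threeLinesDiffPow_two K)

/-- **Ordinary powers are NOT the order-defined powers** for the three concurrent lines (nontrivial `K`): `¬ ∀ b, D_b = D_1^b` — the
polynomial shadow of «`OrdPowAlong C` fails» for specimen (B); contrast `threeLinesDiffPow_two_mul` (level 2 repairs it). [folklore] -/
theorem not_forall_threeLinesDiffPow_eq_pow [Nontrivial K] : ¬ ∀ b : ℕ, threeLinesDiffPow K b = threeLinesDiffPow K 1 ^ b := fun h =>
  threeLinesDiffPow_two_ne_sq K (h 2)

/-- `D_1^b ≤ D_b` for every `b` (ordinary powers lie in the order-defined ones). [folklore] -/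
theorem threeLinesDiffPow_one_pow_le (b : ℕ) : threeLinesDiffPow K 1 ^ b ≤ threeLinesDiffPow K b := by
  induction b with
  | zero => rw [pow_zero, threeLinesDiffPow_zero, Ideal.one_eq_top]
  | succ b ih =>
    rw [pow_succ]
    exact (Ideal.mul_mono ih le_rfl).trans (threeLinesDiffPow_mul_le K b 1)

end CampaignW36

end Summit.ResolutionOfSingularities.ResolutionOfSingularities.Theorems

end
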